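import Literature.Analysis.FluidPDE.TorusClassicalNSSobolevFourWindow
import HarnessLib

/-!
# A Chebyshev time of controlled `H⁴` Sobolev sums on `T³` (tools stub `stub_sobolevFourWindowTools`,
# block N-E, line `ergodic-budget-selection-closing`, crux `BaireTransfer.DenseLoudDesignerForces`,
# stmt-AnomalousDissipation-1143)

Summit-side specialisation to `T³ = UnitAddTorus (Fin 3)` of the Literature theorem
`Torus.IsClassicalNSSolutionOn.exists_mem_Icc_sobolevFourSum_le_of_le`
(`Literature/Analysis/FluidPDE/TorusClassicalNSSobolevFourWindow.lean`): for `ν > 0` and a classical solution of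
NS_ν on `[a, a + τ] × T³` with zero-mean slices, sup bounds `‖∇u‖₂² ≤ E₁`, `‖Δu‖₂² ≤ Y₁`, `‖∇Δu‖₂² ≤ Z₁` and
`‖Δf‖₂² ≤ G₂` on the interval give a time `t₁ ∈ [a, a + τ]` at which every fourth Sobolev sum
`∑_{k∈S} (1 + |k|²)⁴ ‖û(t₁)(k)‖²`, `S ⊆ ℤ³` finite, is `≤ C(ν, E₁, Y₁, Z₁, G₂, τ)` — the `L²_t H⁴` bound
(Robinson–Rodrigo–Sadowski 2016, Thm 7.1 (7.3), `k = 3`, integrated in time: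
`Torus.IsClassicalNSSolutionOn.intervalIntegral_norm_laplacian_laplacian_sq_le_of_le`) read at the minimiser of
`s ↦ ‖Δ²u(s)‖₂²` (Chebyshev), then the Fourier dictionary `∑_{k∈S} (1 + |k|²)⁴ ‖v̂(k)‖² ≤ ‖Δ²v‖₂²` for smooth
mean-zero fields.  This is the datum shape of the tree's local existence theorem
`Torus.exists_classicalNS_smooth_of_sobolevBound`, through which the continuation argument of block N-E (strong
solutions near the invariant core) restarts.  The registered tools stub `stub_sobolevFourWindowTools` is proved
BY NAME with exactly the registered signature.

References: Robinson–Rodrigo–Sadowski, *The Three-Dimensional Navier–Stokes Equations* (CUP 2016) Thm 7.1 (7.3);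
Grafakos, *Classical Fourier Analysis* (3rd ed., 2014) Props. 3.2.6, 3.2.7.
-/

-- `Summit.<Summit>.<Problem>` is the tree's mandated summit-side namespace (CONVENTIONS §2); for this
-- single-conjunct summit the two coincide, so the duplicate is deliberate.
set_option linter.dupNamespace false

noncomputable section

open scoped BigOperators Topology ENNReal InnerProductSpace
open Filter Set Function MeasureTheory

namespace Summit.AnomalousDissipation.AnomalousDissipation.Theorems.DenseLoudDesignerForces.Ergodic

open Literature.Analysis.FunctionSpaces Literature.Analysis.FunctionSpaces.Torus
open Literature.Analysis.FluidPDE Literature.Analysis.FluidPDE.Torus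

/-- **Tools stub of block N-E (`stub_sobolevFourWindowTools`, crux stmt-AnomalousDissipation-1143, line
`ergodic-budget-selection-closing`) — a Chebyshev time of controlled fourth Sobolev sums.**  For `ν > 0` and a
classical solution of NS_ν on `[a, a + τ] × T³` with zero-mean slices, sup bounds `‖∇u‖₂² ≤ E₁`, `‖Δu‖₂² ≤ Y₁`,
`‖∇Δu‖₂² ≤ Z₁` and `‖Δf‖₂² ≤ G₂` on the interval give a time `t₁ ∈ [a, a + τ]` with
`∑_{k∈S} (1 + |k|²)⁴ ‖û(t₁)(k)‖² ≤ C(ν, E₁, Y₁, Z₁, G₂, τ)` for every finite `S ⊆ ℤ³`: the time-integrated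
`H⁴` bound `∫ₐ^{a+τ} ‖Δ²u‖₂² ≤ C₄` (RRS 2016 Thm 7.1 (7.3), `k = 3`) at the minimiser of the continuous
`s ↦ ‖Δ²u(s)‖₂²` (`τ · min ≤ ∫`), and `∑_{k∈S} (1 + |k|²)⁴ ‖v̂(k)‖² ≤ ‖Δ²v‖₂²` for the smooth mean-zero slice
`v = u(t₁)` (zero mode vanishes, `1 + |k|² ≤ 4π²|k|²` off the origin, bi-Laplacian symbol, Parseval)
(`Torus.IsClassicalNSSolutionOn.exists_mem_Icc_sobolevFourSum_le_of_le` at `d = Fin 3`).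
[cite: RobinsonRodrigoSadowskiCUP2016, Thm 7.1 (7.3)] -/
theorem stub_sobolevFourWindowTools {ν : ℝ} (hν : 0 < ν) (E₁ Y₁ Z₁ G₂ τ : ℝ) (hτ : 0 < τ) :
    ∃ C : ℝ, ∀ {a : ℝ} {f u : ℝ → (UnitAddTorus (Fin 3)) → (EuclideanSpace ℝ (Fin 3))} {p : ℝ → (UnitAddTorus (Fin 3)) → ℝ},
      IsClassicalNSSolutionOn (Icc a (a + τ)) ν f u p → (∀ t ∈ Icc a (a + τ), HasZeroMean (u t)) →
      (∀ t ∈ Icc a (a + τ), gradNormSq (u t) ≤ E₁) → (∀ t ∈ Icc a (a + τ), ∫ x, ‖laplacian (u t) x‖ ^ 2 ≤ Y₁) →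
      (∀ t ∈ Icc a (a + τ), gradNormSq (laplacian (u t)) ≤ Z₁) →
      (∀ t ∈ Icc a (a + τ), ∫ x, ‖laplacian (f t) x‖ ^ 2 ≤ G₂) →
      ∃ t₁ ∈ Icc a (a + τ), ∀ S : Finset (Fin 3 → ℤ),
        ∑ k ∈ S, (1 + freqNormSq k) ^ 4 * ‖UnitAddTorus.mFourierCoeff (EuclideanSpace.complexify ∘ u t₁) k‖ ^ 2 ≤ C :=
  IsClassicalNSSolutionOn.exists_mem_Icc_sobolevFourSum_le_of_le (d := Fin 3)
    (Fintype.card_fin 3) hν E₁ Y₁ Z₁ G₂ hτ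

end Summit.AnomalousDissipation.AnomalousDissipation.Theorems.DenseLoudDesignerForces.Ergodic

end
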